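import Literature.AlgebraicGeometry.Motives.AbelianVarietyConjugateBaseChangeAlong
import HarnessLib

/-!
# Conjugation of abelian varieties is functorial in the automorphism: `(A^τ)^σ ≅ A^{σ∘τ}` and `A^{id} ≅ A`,
# compatibly with points (`(x^τ)^σ = x^{σ∘τ}`, `x^{id} = x`) and with homomorphisms

Layer `Literature/AlgebraicGeometry/Motives`, namespace `Literature.AlgebraicGeometry.Motives[.AbelianVariety]`.
KERNEL ONLY: theorems (the isomorphisms are produced in `∃`-form, as in ★ `AbelianVarietyConjugateBiprod`); no
definition, no named fact, no instance, no `sorry`.  Sequel of ★ `AbelianVarietyConjugate` (`A^σ = A ×_{L,σ} L`,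
`x ↦ x^σ` = `conjPoints`, `f ↦ f^σ` = `Hom.conjugate`, API `conjPoints_map`, `conjPoints_left_comp_fst`,
`Points.ext_of_comp_fst`) and ★ `AbelianVarietyConjugateBaseChangeAlong` (the twist functor
`twistFunctor σ = Over.pullback (Spec σ)` with `(A^σ).toGrp = (twistFunctor σ).mapGrp.obj A.toGrp` by `rfl`, and the
pattern «scheme-level natural iso of `Over.pullback`s ⟶ `Functor.mapGrpNatIso` ⟶ `InducedCategory.isoMk`»).

Milne 2005, §11 p. 108: «a homomorphism `σ : k → Ω` defines a functor `V ↦ σV`, `α ↦ σα`»; the functor of a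
COMPOSITE is the composite of the functors and the functor of the identity is the identity — on fibre products,
`(A ×_{L,τ} L) ×_{L,σ} L = A ×_{L,σ∘τ} L` (transitivity of base change, Görtz–Wedhorn I Prop. 4.16; Mathlib
`Over.pullbackComp`) and `A ×_{L,id} L = A` (Mathlib `Over.pullbackId`).  What is proved (for `τ σ ρ : L ≃+* L`):
* §1 `pullbackId_hom_app_left` — the component of Mathlib's `Over.pullbackId` at `Z` is the first projection
  `Z ×_X X → Z` (conjugation identity for the adjunction `Over.map (𝟙) ⊣ Over.pullback (𝟙)`); `specRingEquiv_eq_comp_of_forall`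
  (`Spec ρ = Spec σ ≫ Spec τ` for `ρ = σ ∘ τ`), `specRingEquiv_refl` (`Spec id = 𝟙`).
* §2 **`exists_iso_conjugate_conjugate (h : ∀ x, ρ x = σ (τ x))`**: a FAMILY of isomorphisms
  `e_A : (A^τ)^σ ≅ A^ρ` (all `A` at once, so that naturality can be stated) with (i) the first-projection formula
  `e_A ≫ pr_ρ = pr_σ ≫ pr_τ`, (ii) POINTS `e_A((x^τ)^σ) = x^ρ` for `x ∈ A(L)`, (iii) NATURALITY `(f^τ)^σ ≫ e_B = e_A ≫ f^ρ`.
* §3 **`exists_iso_conjugate_refl`**: a family `e_A : A^{id} ≅ A` with `e_A = pr` on schemes, `e_A(x^{id}) = x` on points,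
  `f^{id} ≫ e_B = e_A ≫ f` — the «canonical `A^{id} ≅ A` on points» that the T1′ slot `slot_isModuli_sigma_one`
  (cell `hodgecm-mathlib`, B-typ04, REF1 (4a)) takes as its only abstracted hypothesis `he`.
* §4 **`exists_iso_conjugate_conjugate_of_inverse (h : ∀ x, σ (τ x) = x)`** and the two specialisations
  `exists_iso_conjugate_symm_conjugate` (`(A^{σ⁻¹})^σ ≅ A`), `exists_iso_conjugate_conjugate_symm` (`(A^σ)^{σ⁻¹} ≅ A`),
  on points `e_A((x^τ)^σ) = x` and natural — «conjugating back», the cocycle bookkeeping of any `Aut(L)`-ACTION built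
  from `A ↦ A^σ` (e.g. on moduli points, Milne §12 (55) `σ(A, i, ηK) = (σA, σi, σηK)`).

## References
* [Milne2005ShimuraVarieties] J. S. Milne, *Introduction to Shimura varieties* (2005), §11 p. 108 («the functor σ»),
  §12 (55) p. 106.
* [GortzWedhorn2020] U. Görtz, T. Wedhorn, *Algebraic Geometry I* (2nd ed. 2020), Prop. 4.16 and §(4.7) (transitivity
  of fibre products / base change), Remark 16.54 (base change of group schemes).
-/

set_option backward.defeqAttrib.useBackward true
set_option backward.isDefEq.respectTransparency false

universe u

open CategoryTheory CategoryTheory.Limits AlgebraicGeometry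

noncomputable section

namespace Literature.AlgebraicGeometry.Motives

/-! ### §1 Scheme-level bookkeeping -/

/-- **The component of Mathlib's `Over.pullbackId : Over.pullback (𝟙 X) ≅ 𝟭` at `Z` is the first projection
`Z ×_X X → Z`** (underlying morphism; the conjugation identity `conjugateEquiv_counit` for the adjunctions
`Over.map (𝟙 X) ⊣ Over.pullback (𝟙 X)` and `𝟭 ⊣ 𝟭`, read on objects — same bookkeeping as the tree's
`pullbackComp_inv_app_left_comp_fst`). [cite: GortzWedhorn2020, §(4.7) (base change along the identity)] -/
theorem pullbackId_hom_app_left {X : Scheme.{u}} (Z : Over X) :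
    ((Over.pullbackId (X := X)).hom.app Z).left = pullback.fst Z.hom (𝟙 X) := by
  have h := conjugateEquiv_counit (Over.mapPullbackAdj (𝟙 X)) (Adjunction.id (C := Over X))
    (Over.mapId X).inv Z
  have h' := congrArg CommaMorphism.left h
  simp only [Functor.id_map, Adjunction.id_counit, NatTrans.id_app, Over.comp_left,
    Over.mapPullbackAdj_counit_app, Over.homMk_left, Functor.comp_obj, Functor.id_obj,
    Category.comp_id] at h'
  rw [Over.pullbackId, conjugateIsoEquiv_apply_hom, Iso.symm_hom]
  refine h'.trans ?_
  simp [Over.mapId]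

namespace AbelianVariety

variable {L : Type u} [Field L]

/-- `Spec ρ = Spec σ ≫ Spec τ` for automorphisms with `ρ = σ ∘ τ` (contravariance of `Spec`). [cite: GortzWedhorn2020, §(4.7)] -/
theorem specRingEquiv_eq_comp_of_forall (τ σ ρ : L ≃+* L) (h : ∀ x, ρ x = σ (τ x)) :
    specRingEquiv ρ = specRingEquiv σ ≫ specRingEquiv τ := by
  change Spec.map _ = Spec.map _ ≫ Spec.map _
  rw [← Spec.map_comp, ← CommRingCat.ofHom_comp]
  congr 2
  exact RingHom.ext fun x => h x

/-- `Spec (id_L) = 𝟙_{Spec L}`. [cite: GortzWedhorn2020, §(4.7)] -/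
theorem specRingEquiv_refl : specRingEquiv (RingEquiv.refl L) = 𝟙 (Spec (.of L)) := by
  change Spec.map (CommRingCat.ofHom (RingHom.id L)) = 𝟙 _
  rw [CommRingCat.ofHom_id, Spec.map_id]

/-! ### §2 `(A^τ)^σ ≅ A^ρ` for `ρ = σ ∘ τ` -/

/-- **`(A^τ)^σ ≅ A^ρ` for `ρ = σ ∘ τ`, naturally in `A`, with `(x^τ)^σ ↦ x^ρ` on points** (transitivity of base
change `(A ×_{L,τ} L) ×_{L,σ} L ≅ A ×_{L,σ∘τ} L`, Görtz–Wedhorn I Prop. 4.16 / Mathlib `Over.pullbackComp`, lifted to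
group objects by `Functor.mapGrpCompIso`/`mapGrpNatIso` and to abelian varieties by `InducedCategory.isoMk`).  A FAMILY
`e_A` is produced so that (iii) NATURALITY `(f^τ)^σ ≫ e_B = e_A ≫ f^ρ` can be stated; (i) first projections
`e_A ≫ pr_ρ = pr_σ ≫ pr_τ`; (ii) points: `e_A((x^τ)^σ) = x^ρ` (both lie over `Spec ρ ≫ x = Spec σ ≫ Spec τ ≫ x`,
★ `conjPoints_left_comp_fst`, `Points.ext_of_comp_fst`).  Milne's functor `σ` composes: `(στ)V = σ(τV)`.
[cite: Milne2005ShimuraVarieties, §11 p. 108 («the functor σ»)] [cite: GortzWedhorn2020, Prop. 4.16 and Remark 16.54] -/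
theorem exists_iso_conjugate_conjugate (τ σ ρ : L ≃+* L) (h : ∀ x, ρ x = σ (τ x)) :
    ∃ e : ∀ A : AbelianVariety L, (A.conjugate τ).conjugate σ ≅ A.conjugate ρ,
      (∀ A : AbelianVariety L,
        Hom.toSchemeHom (e A).hom ≫ baseChangeHomFst ρ.toRingHom A.X =
          baseChangeHomFst σ.toRingHom (A.conjugate τ).X ≫ baseChangeHomFst τ.toRingHom A.X) ∧
      (∀ (A : AbelianVariety L) (P : A.Points L),
        AlgPoints.map (e A).hom.hom.hom.hom ((A.conjugate τ).conjPoints σ (A.conjPoints τ P)) =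
          A.conjPoints ρ P) ∧
      ∀ (A B : AbelianVariety L) (f : A ⟶ B),
        Hom.conjugate σ (Hom.conjugate τ f) ≫ (e B).hom = (e A).hom ≫ Hom.conjugate ρ f := by
  -- the scheme-level natural isomorphism `twist τ ⋙ twist σ ≅ twist ρ`
  have hρ : specRingEquiv σ ≫ specRingEquiv τ = specRingEquiv ρ :=
    (specRingEquiv_eq_comp_of_forall τ σ ρ h).symm
  obtain ⟨η, hη⟩ : ∃ η : twistFunctor τ ⋙ twistFunctor σ ≅ twistFunctor ρ,
      ∀ Z : SchemeOver L, (η.hom.app Z).left ≫ pullback.fst Z.hom (specRingEquiv ρ) =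
        pullback.fst ((twistFunctor τ).obj Z).hom (specRingEquiv σ) ≫ pullback.fst Z.hom (specRingEquiv τ) :=
    ⟨(Over.pullbackComp (specRingEquiv σ) (specRingEquiv τ)).symm ≪≫ overPullbackCongr hρ, fun Z => by
      rw [Iso.trans_hom, NatTrans.comp_app, Over.comp_left, Category.assoc, Iso.symm_hom,
        overPullbackCongr_hom_app_left_comp_fst, pullbackComp_inv_app_left_comp_fst]⟩
  -- its lift to group objects
  obtain ⟨θ, hθ⟩ : ∃ θ : (twistFunctor τ).mapGrp ⋙ (twistFunctor σ).mapGrp ≅ (twistFunctor ρ).mapGrp,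
      ∀ G, (θ.hom.app G).hom.hom = η.hom.app G.X :=
    ⟨(Functor.mapGrpCompIso (F := twistFunctor τ) (G := twistFunctor σ)).symm ≪≫ Functor.mapGrpNatIso η,
      fun G => by
        simp [Functor.mapGrpCompIso, Functor.mapGrpNatIso]⟩
  refine ⟨fun A => InducedCategory.isoMk (θ.app A.toGrp), fun A => ?_, fun A P => ?_, fun A B f => ?_⟩
  · -- first projections
    have hl : Hom.toSchemeHom (InducedCategory.isoMk (θ.app A.toGrp) :
        (A.conjugate τ).conjugate σ ≅ A.conjugate ρ).hom = (η.hom.app A.X).left := by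
      change (θ.hom.app A.toGrp).hom.hom.left = _
      rw [hθ]
    rw [hl]
    exact hη A.X
  · -- points: both sides lie over `Spec ρ ≫ P = Spec σ ≫ Spec τ ≫ P`
    have hl : ((InducedCategory.isoMk (θ.app A.toGrp) :
        (A.conjugate τ).conjugate σ ≅ A.conjugate ρ).hom).hom.hom.hom.left = (η.hom.app A.X).left := by
      change (θ.hom.app A.toGrp).hom.hom.left = _
      rw [hθ]
    apply Points.ext_of_comp_fst (σ := ρ.toRingHom)
    rw [conjPoints_left_comp_fst]
    change (((A.conjugate τ).conjPoints σ (A.conjPoints τ P)) ≫ _).left ≫ _ = _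
    rw [Over.comp_left, hl, Category.assoc]
    change _ ≫ (η.hom.app A.X).left ≫ pullback.fst A.X.hom (specRingEquiv ρ) = _
    rw [hη A.X]
    change ((A.conjugate τ).conjPoints σ (A.conjPoints τ P)).left ≫
        baseChangeHomFst σ.toRingHom (A.conjugate τ).X ≫ baseChangeHomFst τ.toRingHom A.X = _
    rw [conjPoints_left_comp_fst_assoc]
    simp only [Category.assoc]
    rw [conjPoints_left_comp_fst, ← Category.assoc]
    exact congrArg (· ≫ P.left) hρ
  · -- naturality, read on the underlying `L`-schemes
    apply hom_ext
    change (Hom.conjugate σ (Hom.conjugate τ f)).hom.hom.hom ≫ (θ.hom.app B.toGrp).hom.hom =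
      (θ.hom.app A.toGrp).hom.hom ≫ (Hom.conjugate ρ f).hom.hom.hom
    rw [hθ, hθ]
    exact η.hom.naturality f.hom.hom.hom

/-! ### §3 `A^{id} ≅ A` -/

/-- **`A^{id} ≅ A`, naturally in `A`, with `x^{id} ↦ x` on points** (base change along the identity is the identity,
Mathlib `Over.pullbackId`, lifted by `Functor.mapGrpNatIso`/`mapGrpIdIso`): a family `e_A : A^{id} ≅ A` whose underlying
morphism IS the first projection `A ×_{L,id} L → A` (so `e_A(x^{id}) = x`: `x^{id}` lies over `Spec id ≫ x = x`), with
`f^{id} ≫ e_B = e_A ≫ f`.  This is the hypothesis `he : ∀ P, e(P^{id}) = P` of the T1′ σ = 1 slot, discharged.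
[cite: Milne2005ShimuraVarieties, §11 p. 108 («the functor σ»)] [cite: GortzWedhorn2020, §(4.7) and Remark 16.54] -/
theorem exists_iso_conjugate_refl :
    ∃ e : ∀ A : AbelianVariety L, A.conjugate (RingEquiv.refl L) ≅ A,
      (∀ A : AbelianVariety L,
        Hom.toSchemeHom (e A).hom = baseChangeHomFst (RingEquiv.refl L).toRingHom A.X) ∧
      (∀ (A : AbelianVariety L) (P : A.Points L),
        AlgPoints.map (e A).hom.hom.hom.hom (A.conjPoints (RingEquiv.refl L) P) = P) ∧
      ∀ (A B : AbelianVariety L) (f : A ⟶ B),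
        Hom.conjugate (RingEquiv.refl L) f ≫ (e B).hom = (e A).hom ≫ f := by
  obtain ⟨η, hη⟩ : ∃ η : twistFunctor (RingEquiv.refl L) ≅ 𝟭 (SchemeOver L),
      ∀ Z : SchemeOver L, (η.hom.app Z).left = pullback.fst Z.hom (specRingEquiv (RingEquiv.refl L)) :=
    ⟨overPullbackCongr (specRingEquiv_refl (L := L)) ≪≫ Over.pullbackId, fun Z => by
      rw [Iso.trans_hom, NatTrans.comp_app, Over.comp_left, pullbackId_hom_app_left,
        overPullbackCongr_hom_app_left_comp_fst]⟩
  obtain ⟨θ, hθ⟩ : ∃ θ : (twistFunctor (RingEquiv.refl L)).mapGrp ≅ 𝟭 (Grp (SchemeOver L)),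
      ∀ G, (θ.hom.app G).hom.hom = η.hom.app G.X :=
    ⟨Functor.mapGrpNatIso η ≪≫ Functor.mapGrpIdIso, fun G => by
      simp [Functor.mapGrpIdIso, Functor.mapGrpNatIso]⟩
  refine ⟨fun A => InducedCategory.isoMk (θ.app A.toGrp), fun A => ?_, fun A P => ?_, fun A B f => ?_⟩
  · change (θ.hom.app A.toGrp).hom.hom.left = _
    rw [hθ]
    exact hη A.X
  · have hl : ((InducedCategory.isoMk (θ.app A.toGrp) :
        A.conjugate (RingEquiv.refl L) ≅ A).hom).hom.hom.hom.left = (η.hom.app A.X).left := by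
      change (θ.hom.app A.toGrp).hom.hom.left = _
      rw [hθ]
    ext : 1
    change ((A.conjPoints (RingEquiv.refl L) P) ≫ _).left = P.left
    rw [Over.comp_left, hl, hη A.X]
    change (A.conjPoints (RingEquiv.refl L) P).left ≫ baseChangeHomFst (RingEquiv.refl L).toRingHom A.X = P.left
    rw [conjPoints_left_comp_fst]
    change specRingEquiv (RingEquiv.refl L) ≫ P.left = P.left
    rw [specRingEquiv_refl, Category.id_comp]
  · exact InducedCategory.hom_ext (θ.hom.naturality f.hom)

/-! ### §4 `(A^τ)^σ ≅ A` for `σ ∘ τ = id` (conjugating back) -/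

/-- **Conjugating back: `(A^τ)^σ ≅ A` when `σ ∘ τ = id`, with `(x^τ)^σ ↦ x` and `(f^τ)^σ ≫ e_B = e_A ≫ f`**
(§2 at `ρ = id` composed with §3). [cite: Milne2005ShimuraVarieties, §11 p. 108; §12 (55) p. 106] -/
theorem exists_iso_conjugate_conjugate_of_inverse (τ σ : L ≃+* L) (h : ∀ x, σ (τ x) = x) :
    ∃ e : ∀ A : AbelianVariety L, (A.conjugate τ).conjugate σ ≅ A,
      (∀ (A : AbelianVariety L) (P : A.Points L),
        AlgPoints.map (e A).hom.hom.hom.hom ((A.conjugate τ).conjPoints σ (A.conjPoints τ P)) = P) ∧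
      ∀ (A B : AbelianVariety L) (f : A ⟶ B),
        Hom.conjugate σ (Hom.conjugate τ f) ≫ (e B).hom = (e A).hom ≫ f := by
  obtain ⟨e₁, -, he₁, hn₁⟩ := exists_iso_conjugate_conjugate τ σ (RingEquiv.refl L) fun x => (h x).symm
  obtain ⟨e₂, -, he₂, hn₂⟩ := exists_iso_conjugate_refl (L := L)
  refine ⟨fun A => e₁ A ≪≫ e₂ A, fun A P => ?_, fun A B f => ?_⟩
  · change AlgPoints.map ((e₁ A).hom ≫ (e₂ A).hom).hom.hom.hom _ = P
    rw [show AlgPoints.map ((e₁ A).hom ≫ (e₂ A).hom).hom.hom.hom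
          ((A.conjugate τ).conjPoints σ (A.conjPoints τ P)) =
        AlgPoints.map (e₂ A).hom.hom.hom.hom
          (AlgPoints.map (e₁ A).hom.hom.hom.hom ((A.conjugate τ).conjPoints σ (A.conjPoints τ P))) from
      (Category.assoc _ _ _).symm, he₁, he₂]
  · change Hom.conjugate σ (Hom.conjugate τ f) ≫ (e₁ B).hom ≫ (e₂ B).hom = ((e₁ A).hom ≫ (e₂ A).hom) ≫ f
    rw [← Category.assoc, hn₁, Category.assoc, hn₂, Category.assoc]

/-- **`(A^{σ⁻¹})^σ ≅ A`** naturally, `(x^{σ⁻¹})^σ ↦ x` on points. [cite: Milne2005ShimuraVarieties, §11 p. 108; §12 (55) p. 106] -/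
theorem exists_iso_conjugate_symm_conjugate (σ : L ≃+* L) :
    ∃ e : ∀ A : AbelianVariety L, (A.conjugate σ.symm).conjugate σ ≅ A,
      (∀ (A : AbelianVariety L) (P : A.Points L),
        AlgPoints.map (e A).hom.hom.hom.hom ((A.conjugate σ.symm).conjPoints σ (A.conjPoints σ.symm P)) = P) ∧
      ∀ (A B : AbelianVariety L) (f : A ⟶ B),
        Hom.conjugate σ (Hom.conjugate σ.symm f) ≫ (e B).hom = (e A).hom ≫ f :=
  exists_iso_conjugate_conjugate_of_inverse σ.symm σ σ.apply_symm_apply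

/-- **`(A^σ)^{σ⁻¹} ≅ A`** naturally, `(x^σ)^{σ⁻¹} ↦ x` on points. [cite: Milne2005ShimuraVarieties, §11 p. 108; §12 (55) p. 106] -/
theorem exists_iso_conjugate_conjugate_symm (σ : L ≃+* L) :
    ∃ e : ∀ A : AbelianVariety L, (A.conjugate σ).conjugate σ.symm ≅ A,
      (∀ (A : AbelianVariety L) (P : A.Points L),
        AlgPoints.map (e A).hom.hom.hom.hom ((A.conjugate σ).conjPoints σ.symm (A.conjPoints σ P)) = P) ∧
      ∀ (A B : AbelianVariety L) (f : A ⟶ B),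
        Hom.conjugate σ.symm (Hom.conjugate σ f) ≫ (e B).hom = (e A).hom ≫ f :=
  exists_iso_conjugate_conjugate_of_inverse σ σ.symm σ.symm_apply_apply

end AbelianVariety

end Literature.AlgebraicGeometry.Motives

end
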